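import Mathlib

/-!
# `Balaban1983to89.B11CriticalSlice` — [Balaban1985Variational] p. 297: «a critical point in the subspace (42), (43) is
# also a critical point in the space (43), (123)» — the differential-calculus step, PROVED in abstract form

statement-level skeleton of published theorems with citation tags; proofs where landed; nothing here is a claim about the Yang–Mills mass gap

CITATION HEADER (lean-in-tree rule 2026-08-18).  T. Bałaban, *The variational problem and background fields in
renormalization group method for lattice gauge theories*, Commun. Math. Phys. **102**, 277–309 (1985),
doi:10.1007/bf01229381 [Balaban1985Variational] (cell paper B11; held `paper:balaban1985-cmp102-variational-background`,
journal page = PDF page + 276).  Render `run/shared/lean/pub/pub-balaban/b2b-balaban-ref1/pages/1985-cmp102-variational-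
background/1985-cmp102-variational-background-p021-x2.png` (journal p. 297) READ AS AN IMAGE by this seat (lit-balaban
reader/typer r08, 2026-08-20); pp. 296–297 (123)–(126) cross-checked with the render-verified transcript
`run/shared/lean/pub/pub-balaban/b2b-balaban-b11/transcript.md`.

THE PRINT (pp. 296–297 [PDF 20–21], verbatim).  The critical configuration of Sect. E lives in the space (42), (43)
(Landau gauge `RD*A = 0`); to get the second-order bounds of (19) the author enlarges the space to (43) and *«RD*A = f,
f ∈ R, |f|_{(−2)} < γε₂, (123)»* and argues: *«For functions f small, e.g. satisfying the last condition in (123), all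
the results of that section [Sect. D of [6]] are valid, and Eqs. (125) have a unique solution. This solution defines a
configuration A = 1/iη log U₁^{u′−1} satisfying (123). Thus the space (43), (123) can be represented as a union of
submanifolds, each submanifold intersecting the subspace (42), (43) at exactly one point, and contained in an orbit of
the group of gauge transformations. This implies that the functional A(U₁U₀) is constant on the submanifolds, and a
critical point in the subspace (42), (43) is also a critical point in the space (43), (123). This conclusion applies to
the constructed critical configuration.»*

WHAT IS PROVED HERE (abstract form of the last implication; Mathlib only).  Normed spaces `E` (the configurations A of
(43), (123)), `P` (a parameter space of the union of submanifolds: slice point × fibre coordinate f), `F` (values of the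
functional); `Φ : P → E` the parametrisation of the big space by the submanifolds, `σ : P → E` the map "intersection point
of the submanifold with the subspace (42), (43)", both differentiable at `p₀` with `Φ p₀ = σ p₀ = x₀` (the constructed
critical configuration); INVARIANCE `f (Φ p) = f (σ p)` near `p₀` (*«A(U₁U₀) is constant on the submanifolds»*);
CRITICALITY ON THE SUBSPACE in the form `f′ ∘ σ′ = 0` (the range of `σ′` is tangent to the subspace, on which the
differential of `f` vanishes).  Conclusions: `fderiv_comp_param_eq_zero` — `f′ ∘ Φ′ = 0`; `critical_of_invariant_fibration`
— if `Φ′` is onto (the submanifolds sweep a neighbourhood: *«each submanifold intersecting the subspace … at exactly one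
point»* + *«Eqs. (125) have a unique solution»*), then `f′ = 0`, i.e. `x₀` is critical in the big space.  NOT modelled:
the analytic input (existence/uniqueness for (125) = [6] Sect. D / Thm 8, by reference; cell row G-B11-E3), the
identification of `P`, `Φ`, `σ` with gauge orbits.  Unit `lit-balaban-r08` (skeleton row r08.59 of
`HOME/lit-balaban-r08/SKELETON-r08.md`).
-/

open Filter Topology

namespace Literature.MathematicalPhysics.QuantumFieldTheory.Balaban1983to89.B11CriticalSlice

variable {𝕜 : Type*} [NontriviallyNormedField 𝕜]
  {E : Type*} [NormedAddCommGroup E] [NormedSpace 𝕜 E]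
  {P : Type*} [NormedAddCommGroup P] [NormedSpace 𝕜 P]
  {F : Type*} [NormedAddCommGroup F] [NormedSpace 𝕜 F]

/-- p. 297: invariance of the functional along the submanifolds (`f ∘ Φ = f ∘ σ` near `p₀`) and criticality on the
subspace (`f′ ∘ σ′ = 0`) give `f′ ∘ Φ′ = 0` — the differential of `f` at `x₀ = Φ p₀ = σ p₀` vanishes on the range of
`Φ′` (chain rule on both sides + uniqueness of the Fréchet derivative). [cite: Balaban1985Variational, p.297 after (125)] -/
theorem fderiv_comp_param_eq_zero {f : E → F} {Φ σ : P → E} {p₀ : P} {f' : E →L[𝕜] F} {Φ' σ' : P →L[𝕜] E}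
    (hΦσ : Φ p₀ = σ p₀) (hf : HasFDerivAt f f' (Φ p₀)) (hΦ : HasFDerivAt Φ Φ' p₀) (hσ : HasFDerivAt σ σ' p₀)
    (hinv : (fun p => f (Φ p)) =ᶠ[𝓝 p₀] fun p => f (σ p)) (hcrit : f'.comp σ' = 0) :
    f'.comp Φ' = 0 := by
  have h1 : HasFDerivAt (fun p => f (Φ p)) (f'.comp Φ') p₀ := hf.comp p₀ hΦ
  have hfσ : HasFDerivAt f f' (σ p₀) := hΦσ ▸ hf
  have h2 : HasFDerivAt (fun p => f (σ p)) (f'.comp σ') p₀ := hfσ.comp p₀ hσ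
  have h2' : HasFDerivAt (fun p => f (Φ p)) (f'.comp σ') p₀ := h2.congr_of_eventuallyEq hinv
  rw [h1.unique h2', hcrit]

/-- **p. 297, the implication «a critical point in the subspace (42), (43) is also a critical point in the space (43),
(123)»**, abstract form: if in addition the parametrisation `Φ` of the big space by the gauge submanifolds has onto
differential at `p₀` (the submanifolds through the subspace sweep a neighbourhood), then the differential of `f` at
`x₀` vanishes identically. [cite: Balaban1985Variational, p.297 after (125)] -/
theorem critical_of_invariant_fibration {f : E → F} {Φ σ : P → E} {p₀ : P} {f' : E →L[𝕜] F} {Φ' σ' : P →L[𝕜] E}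
    (hΦσ : Φ p₀ = σ p₀) (hf : HasFDerivAt f f' (Φ p₀)) (hΦ : HasFDerivAt Φ Φ' p₀) (hσ : HasFDerivAt σ σ' p₀)
    (hinv : (fun p => f (Φ p)) =ᶠ[𝓝 p₀] fun p => f (σ p)) (hcrit : f'.comp σ' = 0)
    (honto : Function.Surjective Φ') : f' = 0 := by
  have h := fderiv_comp_param_eq_zero hΦσ hf hΦ hσ hinv hcrit
  ext x
  obtain ⟨p, rfl⟩ := honto x
  have := congrArg (fun T : P →L[𝕜] F => T p) h
  simpa using this

/-- The criticality hypothesis in the form the paper uses it: if `f′` vanishes on a subspace `T` (the tangent space of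
(42), (43)) and `σ′` takes values in `T` (σ maps into the subspace), then `f′ ∘ σ′ = 0`.
[cite: Balaban1985Variational, p.297 after (125)] -/
theorem comp_eq_zero_of_range_le {f' : E →L[𝕜] F} {σ' : P →L[𝕜] E} (T : Submodule 𝕜 E)
    (hT : ∀ v ∈ T, f' v = 0) (hσT : ∀ p, σ' p ∈ T) : f'.comp σ' = 0 := by
  ext p
  simpa using hT _ (hσT p)

end Literature.MathematicalPhysics.QuantumFieldTheory.Balaban1983to89.B11CriticalSlice
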